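import Summits.Schanuel.Schanuel.Theorems.ZilberEacDirectionalDominanceLemmas
import Mathlib.Combinatorics.Nullstellensatz
import Literature.RingTheory.MvPolynomial.BihomogeneousCoefficients
import HarnessLib

/-!
# Integer points of an open cone of lattice directions are Zariski dense

Zilber's Exponential-Algebraic Closedness, case ladder (host summit Schanuel, cell `pub-schanuel`,
seat 2, gen 9).  The admissible rays of the PUNCTURE-regime existence theorems
(`ZilberEacComplexPunctureDecoupling` &c.) are the integer directions `q` with `Re g_D(2πi q) < 0`
(and `qⱼ ≠ 0`): the integer points of an open cone off the coordinate hyperplanes.  THEOREM J′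
(`ZilberEacDirectionalDominancePuncture`) needs that no nonzero polynomial vanishes at `2πi q` for
all of them:

* `eval_two_pi_I_natMul` — `L(2πi N y) = N^D L(2πi y)` for `L` homogeneous of degree `D`;
* `coneLatticeDirections_dense` — given `L` homogeneous, `q₀ ∈ ℤ^t` with `Re L(2πi q₀) < 0` and all
  `q₀ⱼ ≠ 0`, every nonzero `G` has `G(2πi q) ≠ 0` for some admissible `q`: the grids
  `N q₀ + [0, M)^t` lie in the cone for `N ≫ M` (continuity + homogeneity), and a polynomial
  vanishing on a grid with more than `deg_{Xᵢ}` points per side is zero (Alon,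
  `MvPolynomial.eq_zero_of_eval_zero_at_prod_finset`).

HONEST FRAMING: an elementary lemma; `EC(3,2)` OPEN; nothing here bears on Schanuel's conjecture.
-/

noncomputable section

open MvPolynomial Filter Topology Finset Complex

set_option linter.dupNamespace false

namespace Summit.Schanuel.Schanuel.Theorems

section Cone

variable {t : ℕ}

/-- Scaling the argument of a homogeneous form of degree `D` by a natural number `N`:
`L(2πi (N y)) = N^D L(2πi y)`. [folklore] -/
theorem eval_two_pi_I_natMul {L : MvPolynomial (Fin t) ℂ} {D : ℕ} (hL : L.IsHomogeneous D)
    (N : ℕ) (y : Fin t → ℂ) :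
    eval (fun i => 2 * Real.pi * I * ((N : ℂ) * y i)) L =
      (N : ℂ) ^ D * eval (fun i => 2 * Real.pi * I * y i) L := by
  have h : (fun i => 2 * Real.pi * I * ((N : ℂ) * y i)) = (N : ℂ) • fun i => 2 * Real.pi * I * y i := by
    funext i; simp only [Pi.smul_apply, smul_eq_mul]; ring
  rw [h, Literature.RingTheory.MvPolynomial.eval_smul_of_isHomogeneous hL]

/-- **Integer points of an open cone, off the coordinate hyperplanes, are Zariski dense** (for
evaluation at `2πi q`).  `L` homogeneous of degree `D`, `q₀ ∈ ℤ^t` with `Re L(2πi q₀) < 0` and all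
`q₀ⱼ ≠ 0`: every nonzero `G` is non-vanishing at `2πi q` for some `q ∈ ℤ^t` with `Re L(2πi q) < 0`
and all `qⱼ ≠ 0`. [folklore] -/
theorem coneLatticeDirections_dense {L : MvPolynomial (Fin t) ℂ} {D : ℕ} (hL : L.IsHomogeneous D)
    {q₀ : Fin t → ℤ} (hq₀ : (eval (fun i => 2 * Real.pi * I * (q₀ i : ℂ)) L).re < 0)
    (hq₀0 : ∀ j, q₀ j ≠ 0) (G : MvPolynomial (Fin t) ℂ) (hG : G ≠ 0) :
    ∃ q : Fin t → ℤ, (eval (fun i => 2 * Real.pi * I * (q i : ℂ)) L).re < 0 ∧ (∀ j, q j ≠ 0) ∧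
      eval (fun i => 2 * Real.pi * I * (q i : ℂ)) G ≠ 0 := by
  classical
  -- continuity of `y ↦ Re L(2πi y)` at `q₀` over real vectors
  set Φ : (Fin t → ℝ) → ℝ := fun y => (eval (fun i => 2 * Real.pi * I * ((y i : ℝ) : ℂ)) L).re with hΦ
  have hΦcont : Continuous Φ := by
    refine Complex.continuous_re.comp ((MvPolynomial.continuous_eval L).comp ?_)
    exact continuous_pi fun i => continuous_const.mul (Complex.continuous_ofReal.comp (continuous_apply i))
  set y₀ : Fin t → ℝ := fun i => (q₀ i : ℝ) with hy₀
  have hΦy₀ : Φ y₀ < 0 := by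
    simp only [hΦ, hy₀, Complex.ofReal_intCast]
    exact hq₀
  obtain ⟨δ, hδ, hδΦ⟩ : ∃ δ > 0, ∀ y, dist y y₀ < δ → Φ y < 0 := by
    have hopen : IsOpen (Φ ⁻¹' Set.Iio 0) := hΦcont.isOpen_preimage _ isOpen_Iio
    obtain ⟨δ, hδ, hball⟩ := Metric.isOpen_iff.1 hopen y₀ hΦy₀
    exact ⟨δ, hδ, fun y hy => hball hy⟩
  -- the scaled polynomial and the grid size
  have h2pi : (2 * Real.pi * I : ℂ) ≠ 0 := Complex.two_pi_I_ne_zero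
  set Gs := bind₁ (fun i => C (2 * Real.pi * I : ℂ) * X i) G with hGs
  have hGs0 : Gs ≠ 0 := bind₁_scale_ne_zero hG h2pi
  have hGs_eval : ∀ q : Fin t → ℤ, eval (fun i => (q i : ℂ)) Gs =
      eval (fun i => 2 * Real.pi * I * (q i : ℂ)) G := by
    intro q
    change eval₂Hom (RingHom.id ℂ) (fun i => (q i : ℂ)) (bind₁ _ G) = _
    rw [eval₂Hom_bind₁]
    have : (fun i => eval₂Hom (RingHom.id ℂ) (fun i => (q i : ℂ))
        (C (2 * Real.pi * I : ℂ) * X i : MvPolynomial (Fin t) ℂ)) =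
        fun i => 2 * Real.pi * I * (q i : ℂ) := by
      funext i; simp
    rw [this]
    rfl
  set M : ℕ := ∑ i, Gs.degreeOf i + 1 with hM
  have hMdeg : ∀ i, Gs.degreeOf i < M := fun i => by
    have := Finset.single_le_sum (f := fun i => Gs.degreeOf i) (fun _ _ => Nat.zero_le _)
      (Finset.mem_univ i)
    rw [hM]; omega
  -- the scale `N`
  obtain ⟨N, hNM, hNδ, hN0⟩ : ∃ N : ℕ, (M : ℝ) < N ∧ (M : ℝ) < δ * N ∧ 0 < N := by
    obtain ⟨N, hN⟩ := exists_nat_gt (max (M : ℝ) ((M : ℝ) / δ))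
    refine ⟨N, lt_of_le_of_lt (le_max_left _ _) hN, ?_, ?_⟩
    · have := lt_of_le_of_lt (le_max_right _ _) hN
      rw [div_lt_iff₀ hδ] at this
      linarith
    · exact_mod_cast lt_of_le_of_lt (by positivity : (0 : ℝ) ≤ max (M : ℝ) _) hN
  -- the grid `N q₀ + [0, M)^t`
  set Sgrid : Fin t → Finset ℂ := fun i =>
    (Finset.range M).image fun k : ℕ => (((N : ℤ) * q₀ i + k : ℤ) : ℂ) with hSgrid
  have hcard : ∀ i, Gs.degreeOf i < #(Sgrid i) := by
    intro i
    rw [hSgrid, Finset.card_image_of_injective _ (fun k₁ k₂ h => by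
      have h' : ((N : ℤ) * q₀ i + k₁ : ℤ) = (N : ℤ) * q₀ i + k₂ := by exact_mod_cast h
      omega), Finset.card_range]
    exact hMdeg i
  obtain ⟨xg, hxg, hxgG⟩ : ∃ xg : Fin t → ℂ, (∀ i, xg i ∈ Sgrid i) ∧ eval xg Gs ≠ 0 := by
    by_contra hcon
    push Not at hcon
    exact hGs0 (MvPolynomial.eq_zero_of_eval_zero_at_prod_finset Gs Sgrid hcard hcon)
  have hk : ∀ i, ∃ k : ℕ, k < M ∧ xg i = (((N : ℤ) * q₀ i + k : ℤ) : ℂ) := by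
    intro i
    obtain ⟨k, hk, hkx⟩ := Finset.mem_image.1 (hxg i)
    exact ⟨k, Finset.mem_range.1 hk, hkx.symm⟩
  choose k hkM hkx using hk
  set q : Fin t → ℤ := fun i => (N : ℤ) * q₀ i + k i with hq
  have hxq : xg = fun i => (q i : ℂ) := funext fun i => by rw [hkx i]
  refine ⟨q, ?_, fun j => ?_, ?_⟩
  · -- inside the cone: `q = N (q₀ + k/N)` with `‖k/N‖ < δ`
    set y : Fin t → ℝ := fun i => (q₀ i : ℝ) + (k i : ℝ) / N with hy
    have hN0r : (0 : ℝ) < N := by exact_mod_cast hN0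
    have hdist : dist y y₀ < δ := by
      refine (dist_pi_lt_iff hδ).2 fun i => ?_
      rw [Real.dist_eq]
      simp only [hy, hy₀, add_sub_cancel_left]
      rw [abs_of_nonneg (by positivity), div_lt_iff₀ hN0r]
      have hki : (k i : ℝ) < M := by exact_mod_cast hkM i
      linarith
    have hΦy := hδΦ y hdist
    simp only [hΦ] at hΦy
    have hqy : (fun i => 2 * Real.pi * I * (q i : ℂ)) =
        fun i => 2 * Real.pi * I * ((N : ℂ) * ((y i : ℝ) : ℂ)) := by
      funext i
      have hN0c : (N : ℂ) ≠ 0 := by exact_mod_cast hN0.ne'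
      simp only [hq, hy]
      push_cast
      rw [mul_add (N : ℂ), mul_div_cancel₀ _ hN0c]
    rw [hqy, eval_two_pi_I_natMul hL]
    have hre : ((N : ℂ) ^ D * eval (fun i => 2 * Real.pi * I * ((y i : ℝ) : ℂ)) L).re =
        (N : ℝ) ^ D * (eval (fun i => 2 * Real.pi * I * ((y i : ℝ) : ℂ)) L).re := by
      rw [show ((N : ℂ)) ^ D = (((N : ℝ) ^ D : ℝ) : ℂ) by push_cast; ring, Complex.re_ofReal_mul]
    rw [hre]
    exact mul_neg_of_pos_of_neg (pow_pos hN0r D) hΦy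
  · -- off the coordinate hyperplanes
    simp only [hq]
    have h1 : (k j : ℤ) < N := by exact_mod_cast (hkM j).trans_le (by exact_mod_cast hNM.le)
    rcases lt_or_gt_of_ne (hq₀0 j) with hneg | hpos
    · have : (N : ℤ) * q₀ j ≤ -(N : ℤ) := by nlinarith
      omega
    · have : (N : ℤ) ≤ (N : ℤ) * q₀ j := by nlinarith
      omega
  · rw [← hGs_eval, ← hxq]
    exact hxgG

end Cone

end Summit.Schanuel.Schanuel.Theorems

end
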